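import Summits.HodgeConjecture.HodgeConjecture.Theorems.R90S4U2LdsSwapOfTwo            -- ★ p862939 (this seat): (MOVER) `comap_ne_self_of_two_of_frame`; brings ★ p03 `swap_of_two_of_exists_moved`, ★ `exists_skew_unit_localRing`
import Summits.HodgeConjecture.HodgeConjecture.Theorems.R90S4U2UnipotentOneParameter    -- ★ (K2E3-p11 g9) the one-parameter FRAME of `N(L⁺_v)`: `exists_oneParam_two`, `oneParam_add`, `oneParam_mem_N`, `exists_oneParam_eq_of_mem_N`, `forall_exists_ball_oneParam_apply_eq`, `exists_charTwist_oneParam`, `exists_torus_conj_oneParam`, `cmDatumLocalCongr_glDiagonal_oneParam`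
import Summits.HodgeConjecture.HodgeConjecture.Theorems.R90S4U2NormIndexTwoFv           -- ★ (K2E3-p11 g9) `exists_ne_zero_toLocalRing_not_norm`
import Literature.NumberTheory.Automorphic.AdeleAddCharLocalNontrivial                   -- ★ `adeleAddCharAt`, `isContinuousNontrivial_adeleAddCharAt`
import HarnessLib

/-!
# R90-TF · S4 «Ch. 13.1–2» — the (SWAP) CLOSING: `stub_R90_S4_U2_ldsSwap` from `stub_R90_S4_U2_ldsTwo` (NAME-SHAPE), over the one-parameter
# FRAME of `N(L⁺_v)` and ★ (MOVER)

Cell `hodgecm-mathlib`, crux H413 (`stmt-HodgeConjecture-24833`, lane `--supports … --as helper`), route of record `HCCMUnconditional`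
(no route verbs; count-neutral).  Programme R90-TF (brief `director/R90-BRIEF.v2.md` 1f40d54518340a35), section S4 = Rogawski Ch. 13.1–2
(base `R90-C131`); seat R90-C131-p01 (g0), the `_ldsSwap` ASSEMBLY (dealer RULING S4-R10 (4)).  THEOREMS ONLY (no `def`, no instance, no
notation, no named fact, no `sorry`); ★-only imports (Theorems cannot import `Cruxes`: the two socket statements of
`Cruxes/H413/Lines/R90_S4_HPacketsU2B.lean` ED. 5 — (TWO) `stub_R90_S4_U2_ldsTwo` :413 and (SWAP) `stub_R90_S4_U2_ldsSwap` :442 — are spelled here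
with B's local abbreviations `U2Loc`, `Φ₂Loc` unfolded, so that `ldsSwap_of_ldsTwo : ‹type_of% stub_R90_S4_U2_ldsTwo› → ‹type_of% stub_R90_S4_U2_ldsSwap›`
by `rfl` on types and B ED. 6 can pay `stub_R90_S4_U2_ldsSwap := ldsSwap_of_ldsTwo stub_R90_S4_U2_ldsTwo`, i.e. (SWAP) modulo (TWO), hence modulo (RED)).

* `ldsSwap_of_ldsTwo` — (SWAP) ⟸ (TWO): ★ (MOVER) at the FRAME (skew unit ★ `exists_skew_unit_localRing`, ★ `exists_oneParam_two`, the Whittaker characters ★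
  `exists_charTwist_oneParam` of `ψ_v` = ★ `adeleAddCharAt`, torus rescaling ★ `exists_torus_conj_oneParam`, outer rescaling ★ `cmDatumLocalCongr_glDiagonal_oneParam`
  at a non-norm parameter ★ `exists_ne_zero_toLocalRing_not_norm`), then ★ p03 `swap_of_two_of_exists_moved`.

HONEST LABEL: HC_CM is proved only modulo the 7 printed citations (2 remaining named inputs: hLiu418 = stmt-HodgeConjecture-24832,
h413 = stmt-HodgeConjecture-24833) until rung 0 closes; this pays (SWAP) only modulo (TWO); REL ≠ ★ ≠ BUILT.

## References
[Rogawski1990] J. D. Rogawski, *Automorphic Representations of Unitary Groups in Three Variables* (1990), §11.1 p. 161, Prop. 11.1.1; §12.1 p. 171 ·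
[LabesseLanglands1979] J.-P. Labesse, R. P. Langlands, *L-indistinguishability for SL(2)*, Canad. J. Math. 31 (1979), §2.
-/

set_option autoImplicit false
-- the mandated namespace (brief §3.4) repeats the single-problem summit's segment (`HodgeConjecture.HodgeConjecture`)
set_option linter.dupNamespace false

noncomputable section

open NumberField IsDedekindDomain
open scoped MatrixGroups
open Representation Literature.NumberTheory.Automorphic Literature.NumberTheory.Automorphic.UnitaryGroup

namespace Summit.HodgeConjecture.HodgeConjecture.R90.S4

variable (L : Type) [Field L] [NumberField L] [IsCMField L]

/-! ## (SWAP) from (TWO): NAME-SHAPE over `Cruxes/H413/Lines/R90_S4_HPacketsU2B.lean` ED. 5 -/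

set_option synthInstance.maxHeartbeats 400000 in  -- instance paths on the CM carrier `∏_{w ∣ v} L_w`
set_option maxHeartbeats 4000000 in  -- class-level bookkeeping on the CM carrier
/-- **(SWAP) ⟸ (TWO)** — `stub_R90_S4_U2_ldsSwap` from `stub_R90_S4_U2_ldsTwo`, NAME-SHAPE (both socket statements spelled with B's `U2Loc`, `Φ₂Loc`
unfolded): at a NON-SPLIT `v`, for smooth `χ₁, χ₂` with `χ₁|F_v^× = ω_{E∕F}`, if `i_{U(Φ₂)}((χ₁, χ₂))` has exactly two constituents, then EVERY similitude of
`(Φ₂)_v` with NON-NORM multiplier MOVES EVERY constituent («`JH(i_G(χ))` is an l.d.s. L-packet», [Rogawski1990, §11.1 p. 161]; [LabesseLanglands1979]: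
`π⁺` is `ψ`-generic, `π⁻` is `ψ_{a₀}`-generic, `Ad(diag(a₀, 1))` exchanges them).  Proof: the one-parameter FRAME of `N(L⁺_v)` (★ K2E3-p11
`R90S4U2UnipotentOneParameter`: `e(x) = [[1, ι_v(x) δ₀], [0, 1]]` for a skew unit `δ₀`, its Whittaker characters `θ_c`, torus and outer rescalings),
the standard additive character `ψ_v` (★ `adeleAddCharAt`), a non-norm parameter `a₀` (★ `exists_ne_zero_toLocalRing_not_norm`), ★ (MOVER)
`comap_ne_self_of_two_of_frame` (one moved constituent: `π₁ ∘ Ad(diag(ι a₀, 1)) ≠ π₁`), and ★ p03 `swap_of_two_of_exists_moved` (one mover ⇒ every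
non-norm similitude moves every constituent, by index two).  B ED. 6 pays `stub_R90_S4_U2_ldsSwap := ldsSwap_of_ldsTwo stub_R90_S4_U2_ldsTwo`.
[cite: Rogawski1990, §11.1 p. 161, Prop. 11.1.1; §12.1 p. 171 case 2)] [cite: LabesseLanglands1979, §2] -/
theorem ldsSwap_of_ldsTwo
    (hTwo : ∀ (L : Type) [Field L] [NumberField L] [IsCMField L] (v : HeightOneSpectrum (𝓞 ↥(maximalRealSubfield L))),
      (∀ w : PlacesOver L v, IsCMField.complexConj L • w.1 = w.1) →
      ∀ (χ₁ : (LocalRing L v)ˣ →* ℂˣ) (χ₂ : ↥(normOneUnits (conjLocal L (IsCMField.complexConj L) v)) →* ℂˣ),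
        IsOpen ((χ₁.ker : Subgroup (LocalRing L v)ˣ) : Set (LocalRing L v)ˣ) →
        IsOpen ((χ₂.ker : Subgroup ↥(normOneUnits (conjLocal L (IsCMField.complexConj L) v))) :
          Set ↥(normOneUnits (conjLocal L (IsCMField.complexConj L) v))) →
        IsQuadraticCharExtension (conjLocal L (IsCMField.complexConj L) v) χ₁ →
        ∃ π₁ π₂ : IrrClass ((cmDatum L 2 (Matrix.of fun i j : Fin 2 => if i.val + j.val + 1 = 2 then (1 : L) else 0)).Local v), π₁ ≠ π₂ ∧
          ∀ c : IrrClass ((cmDatum L 2 (Matrix.of fun i j : Fin 2 => if i.val + j.val + 1 = 2 then (1 : L) else 0)).Local v),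
            c.IsConstituentOf (cmPrincipalSeries L 2 v
              (torusCharPair (conjLocal L (IsCMField.complexConj L) v) (cmLocalForm L 2 v) (cmLocalForm_eq_over L 2 v) 0 χ₁ χ₂)) ↔
              c = π₁ ∨ c = π₂) :
    ∀ (L : Type) [Field L] [NumberField L] [IsCMField L] (v : HeightOneSpectrum (𝓞 ↥(maximalRealSubfield L))),
      (∀ w : PlacesOver L v, IsCMField.complexConj L • w.1 = w.1) →
      ∀ (χ₁ : (LocalRing L v)ˣ →* ℂˣ) (χ₂ : ↥(normOneUnits (conjLocal L (IsCMField.complexConj L) v)) →* ℂˣ),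
        IsOpen ((χ₁.ker : Subgroup (LocalRing L v)ˣ) : Set (LocalRing L v)ˣ) →
        IsOpen ((χ₂.ker : Subgroup ↥(normOneUnits (conjLocal L (IsCMField.complexConj L) v))) :
          Set ↥(normOneUnits (conjLocal L (IsCMField.complexConj L) v))) →
        IsQuadraticCharExtension (conjLocal L (IsCMField.complexConj L) v) χ₁ →
        ∀ π : IrrClass ((cmDatum L 2 (Matrix.of fun i j : Fin 2 => if i.val + j.val + 1 = 2 then (1 : L) else 0)).Local v),
          π.IsConstituentOf (cmPrincipalSeries L 2 v
            (torusCharPair (conjLocal L (IsCMField.complexConj L) v) (cmLocalForm L 2 v) (cmLocalForm_eq_over L 2 v) 0 χ₁ χ₂)) →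
          ∀ (T : GL (Fin 2) (LocalRing L v)) (a : LocalRing L v) (ha : IsUnit a)
            (h : formCongr (conjLocal L (IsCMField.complexConj L) v) T
              ((Matrix.of fun i j : Fin 2 => if i.val + j.val + 1 = 2 then (1 : L) else 0).map (algebraMap L (LocalRing L v))) =
              a • (Matrix.of fun i j : Fin 2 => if i.val + j.val + 1 = 2 then (1 : L) else 0).map (algebraMap L (LocalRing L v))),
            (¬ ∃ z : LocalRing L v, IsUnit z ∧ a = conjLocal L (IsCMField.complexConj L) v z * z) →
            IrrClass.comap (cmDatumLocalCongr L v T ha h) π ≠ π := by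
  intro L _ _ _ v hv χ₁ χ₂ hχ₁ hχ₂ hq π hπ T a ha h hna
  obtain ⟨π₁, π₂, hne, hcons⟩ := hTwo L v hv χ₁ χ₂ hχ₁ hχ₂ hq
  -- the FRAME at `v`: a skew unit, the one-parameter map, the additive character, the Whittaker characters, a non-norm parameter
  obtain ⟨δ₀, hδ₀⟩ := Cruxes.H413.F0P3cU2PrincipalSeriesOpenCellTorusChar.exists_skew_unit_localRing L v
  have hδu : IsUnit (δ₀ : LocalRing L v) := δ₀.isUnit
  obtain ⟨e, he⟩ := exists_oneParam_two L v hδ₀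
  have hψ := isContinuousNontrivial_adeleAddCharAt (↥(maximalRealSubfield L)) v
  choose θ hθo hθv using fun c : v.adicCompletion ↥(maximalRealSubfield L) =>
    exists_charTwist_oneParam L v hδ₀ he hδu (adeleAddCharAt (↥(maximalRealSubfield L)) v) hψ.1 c
  obtain ⟨a₀, ha₀, hna₀⟩ := exists_ne_zero_toLocalRing_not_norm L v hv
  -- one moved constituent (★ MOVER), hence (SWAP) (★ p03, index two)
  refine swap_of_two_of_exists_moved L v hv _ hcons ⟨π₁, _, _, isUnit_toLocalRing_of_ne_zero L v ha₀,
    formCongr_glDiagonal_two_eq_smul L v (isUnit_toLocalRing_of_ne_zero L v ha₀) (conjLocal_toLocalRing (IsCMField.complexConj L) v a₀),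
    (hcons π₁).2 (Or.inl rfl), ?_⟩ π hπ T ha h hna
  exact comap_ne_self_of_two_of_frame L v hv χ₁ χ₂ hχ₁ hχ₂ hq hne hcons (adeleAddCharAt (↥(maximalRealSubfield L)) v) hψ e
    (oneParam_add L v he) (oneParam_mem_N L v he) (exists_oneParam_eq_of_mem_N L v hδ₀ he hδu)
    (fun ρ hρ w => forall_exists_ball_oneParam_apply_eq L v he ρ hρ w) θ hθo hθv
    (fun z hz => by
      obtain ⟨n, t, hn, ht⟩ := exists_torus_conj_oneParam L v he hz
      exact ⟨t⁻¹, n, hn, fun y => by rw [inv_inv]; exact ht y⟩)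
    _ (isUnit_toLocalRing_of_ne_zero L v ha₀) _ hna₀ a₀ rfl (cmDatumLocalCongr_glDiagonal_oneParam L v he ha₀)

end Summit.HodgeConjecture.HodgeConjecture.R90.S4

end
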